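import Summits.MatrixMultiplication.OmegaCensus.ThreeSetZ31Killers4420JoinK1P0
import Summits.MatrixMultiplication.OmegaCensus.ThreeSetZ31Killers4420JoinK3P1
import HarnessLib

/-!
# `(4,4,20)@961`: killer `1` (`[28, 29, 30, 30]`) admits no `X`-datum — block assembly, part `1` of `2`

ω-census `pub-omega`, family (b3), seat pub-omega-group gen 40.  Framing: lottery ticket; floor = certified bounds/negative ranges.
VALUE: part of the finite half of the kernel route for the census cell `(4,4,20)@961`: the window theorems of killer `1` assembled over the
leading-entry blocks of `compsLit 31 4` (`ZpZpDomino.compsLit.eq_2`, `LineInv.forall_mem_of_chunks`); leaf blocks first, then their parents.  NOT progress on ω.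
-/

namespace Summit.MatrixMultiplication.OmegaCensus

namespace Z31Killers4420

/-- The refutation property of killer `1`, named once (keeps the assembly's elaboration small). [folklore] -/
def pw1 : List ℕ → Prop :=
  fun Fl => ∀ (G : ZMod 31 → ℕ) (s : ZMod 31), (∀ u, G u ≤ 20) →
      ¬ ∀ τ : ZMod 31, (∑ u : ZMod 31, lineMat3 (vecFn [0,0,0,0,0,0,0,0,0,0,0,0,0,0,0,0,0,0,0,0,0,0,0,0,0,0,0,0,1,1,2]) (vecFn Fl) τ u * G u) + (if s = τ then 1 else 0) = 31

/-- Killer `1`, block `[0]⁸`: windows `0 ≤ i < 12`. [folklore] -/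
theorem kill_k1_b8_g0 : ∀ i : ℕ, i < 12 → ∀ a ∈ (((ZpZpDomino.compsLit 23 4).map (fun l => 0 :: 0 :: 0 :: 0 :: 0 :: 0 :: 0 :: 0 :: l)).drop (450 * i)).take 450, pw1 a := by
  intro i hi
  interval_cases i <;> [exact kill_k1_b8_w0; exact kill_k1_b8_w1; exact kill_k1_b8_w2; exact kill_k1_b8_w3; exact kill_k1_b8_w4; exact kill_k1_b8_w5; exact kill_k1_b8_w6; exact kill_k1_b8_w7; exact kill_k1_b8_w8; exact kill_k1_b8_w9; exact kill_k1_b8_w10; exact kill_k1_b8_w11]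

/-- Killer `1`, block `[0]⁸`: windows `12 ≤ i < 24`. [folklore] -/
theorem kill_k1_b8_g1 : ∀ i : ℕ, 12 ≤ i → i < 24 → ∀ a ∈ (((ZpZpDomino.compsLit 23 4).map (fun l => 0 :: 0 :: 0 :: 0 :: 0 :: 0 :: 0 :: 0 :: l)).drop (450 * i)).take 450, pw1 a := by
  intro i hlo hi
  interval_cases i <;> [exact kill_k1_b8_w12; exact kill_k1_b8_w13; exact kill_k1_b8_w14; exact kill_k1_b8_w15; exact kill_k1_b8_w16; exact kill_k1_b8_w17; exact kill_k1_b8_w18; exact kill_k1_b8_w19; exact kill_k1_b8_w20; exact kill_k1_b8_w21; exact kill_k1_b8_w22; exact kill_k1_b8_w23]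

/-- Killer `1`, block `[0]⁸`: windows `24 ≤ i < 34`. [folklore] -/
theorem kill_k1_b8_g2 : ∀ i : ℕ, 24 ≤ i → i < 34 → ∀ a ∈ (((ZpZpDomino.compsLit 23 4).map (fun l => 0 :: 0 :: 0 :: 0 :: 0 :: 0 :: 0 :: 0 :: l)).drop (450 * i)).take 450, pw1 a := by
  intro i hlo hi
  interval_cases i <;> [exact kill_k1_b8_w24; exact kill_k1_b8_w25; exact kill_k1_b8_w26; exact kill_k1_b8_w27; exact kill_k1_b8_w28; exact kill_k1_b8_w29; exact kill_k1_b8_w30; exact kill_k1_b8_w31; exact kill_k1_b8_w32; exact kill_k1_b8_w33u]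

/-- Killer `1`, block `[0]⁸`: all `34` windows. [folklore] -/
theorem kill_k1_b8_chunks : ∀ i : ℕ, i < 34 → ∀ a ∈ (((ZpZpDomino.compsLit 23 4).map (fun l => 0 :: 0 :: 0 :: 0 :: 0 :: 0 :: 0 :: 0 :: l)).drop (450 * i)).take 450, pw1 a :=
  fun i hi => if h1 : i < 12 then kill_k1_b8_g0 i h1 else if h2 : i < 24 then kill_k1_b8_g1 i (by omega) h2
    else kill_k1_b8_g2 i (by omega) hi

/-- Killer `1`, block `[0, 0, 0, 0, 0, 0, 0, 0]` (14950 data): all refuted (named form). [folklore] -/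
theorem kill_k1_b8_pw : ∀ Fl ∈ ((ZpZpDomino.compsLit 23 4).map (fun l => 0 :: 0 :: 0 :: 0 :: 0 :: 0 :: 0 :: 0 :: l)), pw1 Fl :=
  LineInv.forall_mem_of_chunks ((ZpZpDomino.compsLit 23 4).map (fun l => 0 :: 0 :: 0 :: 0 :: 0 :: 0 :: 0 :: 0 :: l)) pw1 450 34 len_k3_b8 kill_k1_b8_chunks

/-- Killer `1`, block `[0, 0, 0, 0, 0, 0, 0, 0]` (14950 data): all refuted. [folklore] -/
theorem kill_k1_b8 : ∀ Fl ∈ ((ZpZpDomino.compsLit 23 4).map (fun l => 0 :: 0 :: 0 :: 0 :: 0 :: 0 :: 0 :: 0 :: l)), (fun Fl => ∀ (G : ZMod 31 → ℕ) (s : ZMod 31), (∀ u, G u ≤ 20) →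
      ¬ ∀ τ : ZMod 31, (∑ u : ZMod 31, lineMat3 (vecFn [0,0,0,0,0,0,0,0,0,0,0,0,0,0,0,0,0,0,0,0,0,0,0,0,0,0,0,0,1,1,2]) (vecFn Fl) τ u * G u) + (if s = τ then 1 else 0) = 31) Fl :=
  kill_k1_b8_pw

/-- Killer `1`, block `[0, 0, 0, 0, 0, 0, 0]` (17550 data): all refuted (by leading entry). [folklore] -/
theorem kill_k1_b7 : ∀ Fl ∈ ((ZpZpDomino.compsLit 24 4).map (fun l => 0 :: 0 :: 0 :: 0 :: 0 :: 0 :: 0 :: l)), (fun Fl => ∀ (G : ZMod 31 → ℕ) (s : ZMod 31), (∀ u, G u ≤ 20) →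
      ¬ ∀ τ : ZMod 31, (∑ u : ZMod 31, lineMat3 (vecFn [0,0,0,0,0,0,0,0,0,0,0,0,0,0,0,0,0,0,0,0,0,0,0,0,0,0,0,0,1,1,2]) (vecFn Fl) τ u * G u) + (if s = τ then 1 else 0) = 31) Fl := by
  intro F hF
  rw [List.mem_map] at hF
  obtain ⟨F', hF', rfl⟩ := hF
  have hs : ZpZpDomino.compsLit 24 4 =
      (List.range (4 + 1)).flatMap (fun c => (ZpZpDomino.compsLit 23 (4 - c)).map fun l => c :: l) := by
    show ZpZpDomino.compsLit (23 + 1) 4 = _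
    rw [ZpZpDomino.compsLit.eq_2]
  rw [hs, List.mem_flatMap] at hF'
  obtain ⟨c, hc, hF''⟩ := hF'
  rw [List.mem_range] at hc
  rw [List.mem_map] at hF''
  obtain ⟨F'', hmem, rfl⟩ := hF''
  interval_cases c
  · exact kill_k1_b8 _ (List.mem_map.2 ⟨F'', hmem, rfl⟩)
  · exact kill_k1_b9 _ (List.mem_map.2 ⟨F'', hmem, rfl⟩)
  · exact kill_k1_b10 _ (List.mem_map.2 ⟨F'', hmem, rfl⟩)
  · exact kill_k1_b11 _ (List.mem_map.2 ⟨F'', hmem, rfl⟩)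
  · exact kill_k1_b12 _ (List.mem_map.2 ⟨F'', hmem, rfl⟩)

/-- Killer `1`, block `[0, 0, 0, 0, 0, 0]` (20475 data): all refuted (by leading entry). [folklore] -/
theorem kill_k1_b6 : ∀ Fl ∈ ((ZpZpDomino.compsLit 25 4).map (fun l => 0 :: 0 :: 0 :: 0 :: 0 :: 0 :: l)), (fun Fl => ∀ (G : ZMod 31 → ℕ) (s : ZMod 31), (∀ u, G u ≤ 20) →
      ¬ ∀ τ : ZMod 31, (∑ u : ZMod 31, lineMat3 (vecFn [0,0,0,0,0,0,0,0,0,0,0,0,0,0,0,0,0,0,0,0,0,0,0,0,0,0,0,0,1,1,2]) (vecFn Fl) τ u * G u) + (if s = τ then 1 else 0) = 31) Fl := by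
  intro F hF
  rw [List.mem_map] at hF
  obtain ⟨F', hF', rfl⟩ := hF
  have hs : ZpZpDomino.compsLit 25 4 =
      (List.range (4 + 1)).flatMap (fun c => (ZpZpDomino.compsLit 24 (4 - c)).map fun l => c :: l) := by
    show ZpZpDomino.compsLit (24 + 1) 4 = _
    rw [ZpZpDomino.compsLit.eq_2]
  rw [hs, List.mem_flatMap] at hF'
  obtain ⟨c, hc, hF''⟩ := hF'
  rw [List.mem_range] at hc
  rw [List.mem_map] at hF''
  obtain ⟨F'', hmem, rfl⟩ := hF''
  interval_cases c
  · exact kill_k1_b7 _ (List.mem_map.2 ⟨F'', hmem, rfl⟩)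
  · exact kill_k1_b13 _ (List.mem_map.2 ⟨F'', hmem, rfl⟩)
  · exact kill_k1_b14 _ (List.mem_map.2 ⟨F'', hmem, rfl⟩)
  · exact kill_k1_b15 _ (List.mem_map.2 ⟨F'', hmem, rfl⟩)
  · exact kill_k1_b16 _ (List.mem_map.2 ⟨F'', hmem, rfl⟩)

/-- Killer `1`, block `[0, 0, 0, 0, 0]` (23751 data): all refuted (by leading entry). [folklore] -/
theorem kill_k1_b5 : ∀ Fl ∈ ((ZpZpDomino.compsLit 26 4).map (fun l => 0 :: 0 :: 0 :: 0 :: 0 :: l)), (fun Fl => ∀ (G : ZMod 31 → ℕ) (s : ZMod 31), (∀ u, G u ≤ 20) →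
      ¬ ∀ τ : ZMod 31, (∑ u : ZMod 31, lineMat3 (vecFn [0,0,0,0,0,0,0,0,0,0,0,0,0,0,0,0,0,0,0,0,0,0,0,0,0,0,0,0,1,1,2]) (vecFn Fl) τ u * G u) + (if s = τ then 1 else 0) = 31) Fl := by
  intro F hF
  rw [List.mem_map] at hF
  obtain ⟨F', hF', rfl⟩ := hF
  have hs : ZpZpDomino.compsLit 26 4 =
      (List.range (4 + 1)).flatMap (fun c => (ZpZpDomino.compsLit 25 (4 - c)).map fun l => c :: l) := by
    show ZpZpDomino.compsLit (25 + 1) 4 = _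
    rw [ZpZpDomino.compsLit.eq_2]
  rw [hs, List.mem_flatMap] at hF'
  obtain ⟨c, hc, hF''⟩ := hF'
  rw [List.mem_range] at hc
  rw [List.mem_map] at hF''
  obtain ⟨F'', hmem, rfl⟩ := hF''
  interval_cases c
  · exact kill_k1_b6 _ (List.mem_map.2 ⟨F'', hmem, rfl⟩)
  · exact kill_k1_b17 _ (List.mem_map.2 ⟨F'', hmem, rfl⟩)
  · exact kill_k1_b18 _ (List.mem_map.2 ⟨F'', hmem, rfl⟩)
  · exact kill_k1_b19 _ (List.mem_map.2 ⟨F'', hmem, rfl⟩)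
  · exact kill_k1_b20 _ (List.mem_map.2 ⟨F'', hmem, rfl⟩)

/-- Killer `1`, block `[0, 0, 0, 0]` (27405 data): all refuted (by leading entry). [folklore] -/
theorem kill_k1_b4 : ∀ Fl ∈ ((ZpZpDomino.compsLit 27 4).map (fun l => 0 :: 0 :: 0 :: 0 :: l)), (fun Fl => ∀ (G : ZMod 31 → ℕ) (s : ZMod 31), (∀ u, G u ≤ 20) →
      ¬ ∀ τ : ZMod 31, (∑ u : ZMod 31, lineMat3 (vecFn [0,0,0,0,0,0,0,0,0,0,0,0,0,0,0,0,0,0,0,0,0,0,0,0,0,0,0,0,1,1,2]) (vecFn Fl) τ u * G u) + (if s = τ then 1 else 0) = 31) Fl := by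
  intro F hF
  rw [List.mem_map] at hF
  obtain ⟨F', hF', rfl⟩ := hF
  have hs : ZpZpDomino.compsLit 27 4 =
      (List.range (4 + 1)).flatMap (fun c => (ZpZpDomino.compsLit 26 (4 - c)).map fun l => c :: l) := by
    show ZpZpDomino.compsLit (26 + 1) 4 = _
    rw [ZpZpDomino.compsLit.eq_2]
  rw [hs, List.mem_flatMap] at hF'
  obtain ⟨c, hc, hF''⟩ := hF'
  rw [List.mem_range] at hc
  rw [List.mem_map] at hF''
  obtain ⟨F'', hmem, rfl⟩ := hF''
  interval_cases c
  · exact kill_k1_b5 _ (List.mem_map.2 ⟨F'', hmem, rfl⟩)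
  · exact kill_k1_b21 _ (List.mem_map.2 ⟨F'', hmem, rfl⟩)
  · exact kill_k1_b22 _ (List.mem_map.2 ⟨F'', hmem, rfl⟩)
  · exact kill_k1_b23 _ (List.mem_map.2 ⟨F'', hmem, rfl⟩)
  · exact kill_k1_b24 _ (List.mem_map.2 ⟨F'', hmem, rfl⟩)

/-- Killer `1`, block `[0, 0, 0]` (31465 data): all refuted (by leading entry). [folklore] -/
theorem kill_k1_b3 : ∀ Fl ∈ ((ZpZpDomino.compsLit 28 4).map (fun l => 0 :: 0 :: 0 :: l)), (fun Fl => ∀ (G : ZMod 31 → ℕ) (s : ZMod 31), (∀ u, G u ≤ 20) →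
      ¬ ∀ τ : ZMod 31, (∑ u : ZMod 31, lineMat3 (vecFn [0,0,0,0,0,0,0,0,0,0,0,0,0,0,0,0,0,0,0,0,0,0,0,0,0,0,0,0,1,1,2]) (vecFn Fl) τ u * G u) + (if s = τ then 1 else 0) = 31) Fl := by
  intro F hF
  rw [List.mem_map] at hF
  obtain ⟨F', hF', rfl⟩ := hF
  have hs : ZpZpDomino.compsLit 28 4 =
      (List.range (4 + 1)).flatMap (fun c => (ZpZpDomino.compsLit 27 (4 - c)).map fun l => c :: l) := by
    show ZpZpDomino.compsLit (27 + 1) 4 = _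
    rw [ZpZpDomino.compsLit.eq_2]
  rw [hs, List.mem_flatMap] at hF'
  obtain ⟨c, hc, hF''⟩ := hF'
  rw [List.mem_range] at hc
  rw [List.mem_map] at hF''
  obtain ⟨F'', hmem, rfl⟩ := hF''
  interval_cases c
  · exact kill_k1_b4 _ (List.mem_map.2 ⟨F'', hmem, rfl⟩)
  · exact kill_k1_b25 _ (List.mem_map.2 ⟨F'', hmem, rfl⟩)
  · exact kill_k1_b26 _ (List.mem_map.2 ⟨F'', hmem, rfl⟩)
  · exact kill_k1_b27 _ (List.mem_map.2 ⟨F'', hmem, rfl⟩)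
  · exact kill_k1_b28 _ (List.mem_map.2 ⟨F'', hmem, rfl⟩)

/-- Killer `1`, block `[0, 0]` (35960 data): all refuted (by leading entry). [folklore] -/
theorem kill_k1_b2 : ∀ Fl ∈ ((ZpZpDomino.compsLit 29 4).map (fun l => 0 :: 0 :: l)), (fun Fl => ∀ (G : ZMod 31 → ℕ) (s : ZMod 31), (∀ u, G u ≤ 20) →
      ¬ ∀ τ : ZMod 31, (∑ u : ZMod 31, lineMat3 (vecFn [0,0,0,0,0,0,0,0,0,0,0,0,0,0,0,0,0,0,0,0,0,0,0,0,0,0,0,0,1,1,2]) (vecFn Fl) τ u * G u) + (if s = τ then 1 else 0) = 31) Fl := by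
  intro F hF
  rw [List.mem_map] at hF
  obtain ⟨F', hF', rfl⟩ := hF
  have hs : ZpZpDomino.compsLit 29 4 =
      (List.range (4 + 1)).flatMap (fun c => (ZpZpDomino.compsLit 28 (4 - c)).map fun l => c :: l) := by
    show ZpZpDomino.compsLit (28 + 1) 4 = _
    rw [ZpZpDomino.compsLit.eq_2]
  rw [hs, List.mem_flatMap] at hF'
  obtain ⟨c, hc, hF''⟩ := hF'
  rw [List.mem_range] at hc
  rw [List.mem_map] at hF''
  obtain ⟨F'', hmem, rfl⟩ := hF''
  interval_cases c
  · exact kill_k1_b3 _ (List.mem_map.2 ⟨F'', hmem, rfl⟩)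
  · exact kill_k1_b29 _ (List.mem_map.2 ⟨F'', hmem, rfl⟩)
  · exact kill_k1_b30 _ (List.mem_map.2 ⟨F'', hmem, rfl⟩)
  · exact kill_k1_b31 _ (List.mem_map.2 ⟨F'', hmem, rfl⟩)
  · exact kill_k1_b32 _ (List.mem_map.2 ⟨F'', hmem, rfl⟩)

/-- Killer `1`, block `[0]` (40920 data): all refuted (by leading entry). [folklore] -/
theorem kill_k1_b1 : ∀ Fl ∈ ((ZpZpDomino.compsLit 30 4).map (fun l => 0 :: l)), (fun Fl => ∀ (G : ZMod 31 → ℕ) (s : ZMod 31), (∀ u, G u ≤ 20) →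
      ¬ ∀ τ : ZMod 31, (∑ u : ZMod 31, lineMat3 (vecFn [0,0,0,0,0,0,0,0,0,0,0,0,0,0,0,0,0,0,0,0,0,0,0,0,0,0,0,0,1,1,2]) (vecFn Fl) τ u * G u) + (if s = τ then 1 else 0) = 31) Fl := by
  intro F hF
  rw [List.mem_map] at hF
  obtain ⟨F', hF', rfl⟩ := hF
  have hs : ZpZpDomino.compsLit 30 4 =
      (List.range (4 + 1)).flatMap (fun c => (ZpZpDomino.compsLit 29 (4 - c)).map fun l => c :: l) := by
    show ZpZpDomino.compsLit (29 + 1) 4 = _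
    rw [ZpZpDomino.compsLit.eq_2]
  rw [hs, List.mem_flatMap] at hF'
  obtain ⟨c, hc, hF''⟩ := hF'
  rw [List.mem_range] at hc
  rw [List.mem_map] at hF''
  obtain ⟨F'', hmem, rfl⟩ := hF''
  interval_cases c
  · exact kill_k1_b2 _ (List.mem_map.2 ⟨F'', hmem, rfl⟩)
  · exact kill_k1_b33 _ (List.mem_map.2 ⟨F'', hmem, rfl⟩)
  · exact kill_k1_b34 _ (List.mem_map.2 ⟨F'', hmem, rfl⟩)
  · exact kill_k1_b35 _ (List.mem_map.2 ⟨F'', hmem, rfl⟩)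
  · exact kill_k1_b36 _ (List.mem_map.2 ⟨F'', hmem, rfl⟩)

/-- Killer `1`, block `[]` (46376 data): all refuted (by leading entry). [folklore] -/
theorem kill_k1_b0 : ∀ Fl ∈ (ZpZpDomino.compsLit 31 4), (fun Fl => ∀ (G : ZMod 31 → ℕ) (s : ZMod 31), (∀ u, G u ≤ 20) →
      ¬ ∀ τ : ZMod 31, (∑ u : ZMod 31, lineMat3 (vecFn [0,0,0,0,0,0,0,0,0,0,0,0,0,0,0,0,0,0,0,0,0,0,0,0,0,0,0,0,1,1,2]) (vecFn Fl) τ u * G u) + (if s = τ then 1 else 0) = 31) Fl := by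
  intro F hF
  have hs : ZpZpDomino.compsLit 31 4 =
      (List.range (4 + 1)).flatMap (fun c => (ZpZpDomino.compsLit 30 (4 - c)).map fun l => c :: l) := by
    show ZpZpDomino.compsLit (30 + 1) 4 = _
    rw [ZpZpDomino.compsLit.eq_2]
  rw [hs, List.mem_flatMap] at hF
  obtain ⟨c, hc, hF''⟩ := hF
  rw [List.mem_range] at hc
  rw [List.mem_map] at hF''
  obtain ⟨F'', hmem, rfl⟩ := hF''
  interval_cases c
  · exact kill_k1_b1 _ (List.mem_map.2 ⟨F'', hmem, rfl⟩)
  · exact kill_k1_b37 _ (List.mem_map.2 ⟨F'', hmem, rfl⟩)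
  · exact kill_k1_b38 _ (List.mem_map.2 ⟨F'', hmem, rfl⟩)
  · exact kill_k1_b39 _ (List.mem_map.2 ⟨F'', hmem, rfl⟩)
  · exact kill_k1_b40 _ (List.mem_map.2 ⟨F'', hmem, rfl⟩)

/-- **Killer `1` (`[28, 29, 30, 30]`): every `X`-datum of mass `4` is refuted.** [folklore] -/
theorem killer1_all : ∀ Fl ∈ ZpZpDomino.compsLit 31 4, (fun Fl => ∀ (G : ZMod 31 → ℕ) (s : ZMod 31), (∀ u, G u ≤ 20) →
      ¬ ∀ τ : ZMod 31, (∑ u : ZMod 31, lineMat3 (vecFn [0,0,0,0,0,0,0,0,0,0,0,0,0,0,0,0,0,0,0,0,0,0,0,0,0,0,0,0,1,1,2]) (vecFn Fl) τ u * G u) + (if s = τ then 1 else 0) = 31) Fl := kill_k1_b0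

end Z31Killers4420

end Summit.MatrixMultiplication.OmegaCensus
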